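import Mathlib.NumberTheory.ArithmeticFunction.Liouville
import Literature.NumberTheory.Sieve.ParityBarrier
import HarnessLib
import HarnessLib.Audit

/-!
# Barrier (Parity / GeneralizedHardyLittlewood): the parity obstruction for prime pairs —
# Liouville-twisted weights `1 - λ(n)λ(n+2)` (Selberg; Bombieri; Polymath 2014, §8)

`Literature/Barriers/Parity/PrimePairParity.lean` — barrier catalogue entry (D-0021) for the summit
`Parity`, sub-problem `GeneralizedHardyLittlewood` (`Literature.NumberTheory.Sieve.GeneralizedHardyLittlewood`), whose
simplest open instance is the twin-prime system `(n, n + 2)` (`Literature.NumberTheory.Sieve.twinPrimeSystem`, `d = 1`,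
`t = 2`, infinite complexity [cite: GreenTao2010, Examples after Def. 1.5]). The catalogued
declaration is `PrimePairParity` (docstring = BARRIER block), PROVED as a schema
(`PrimePairParity_holds`); the technique class is the explicit predicate
`IsSieveTheoreticDeduction Inputs A` (lower-bound deductions invariant under insertion of a
non-negative weight with the same inputs), and the source's heuristic ingredient (Möbius randomness
for the twisted weights) is isolated as the hypothesis `Inputs ω` and vendored, as printed, as the
registered OPEN CONJECTURES `Polymath2014_liouvilleShiftAPConjecture`, `Polymath2014_liouvillePairAP`
(`[status: open]`; see "Verdict clean-up" below).

Companion entries: the one-prime parity barrier in Selberg's and Bombieri's forms lives in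
`Literature/NumberTheory/Sieve/ParityBarrier.lean` (`Literature.NumberTheory.Sieve.parity_barrier_typeI`,
`Literature.NumberTheory.Sieve.bombieri_asymptotic_sieve_indeterminacy`, `Literature.NumberTheory.Sieve.bombieri_asymptotic_sieve_shiftedPrimes`) and
`Literature/NumberTheory/Sieve/BombieriAsymptoticSieve.lean`; this file is the PAIR version
specific to the binary Hardy–Littlewood problems.

## What the sources print (verified on the page)

* D. H. J. Polymath, *Variants of the Selberg sieve, and bounded intervals containing many primes*,
  Res. Math. Sci. 1:12 (2014), arXiv:1407.4897, §8 "The parity problem" (pp. 35–36 of the arXiv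
  version) [cite: Polymath8b2014, §8]. "we argue why the "parity barrier" of Selberg prohibits
  sieve-theoretic methods, such as the ones in this paper, from obtaining any bound on `H₁` that
  is stronger than `H₁ ≤ 6`, even on the assumption of strong distributional conjectures such as
  the generalized Elliott-Halberstam conjecture `GEH[ϑ]`, and even if one uses sieves other than
  the Selberg sieve. Our discussion will be somewhat informal and heuristic in nature." The
  `H₁ ≤ 6` proof establishes `∑_n ν(n) 1_A(n) > 0` from upper bounds on the discrepancies (8.3)
  `|∑_{x≤n≤2x: n=a (q)} f(n+h) - φ(q)⁻¹ ∑_{x≤n≤2x: (n+h,q)=1} f(n+h)|`, `h ∈ {0,2,6}`,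
  `q ≤ x^{1-ε}`, `f ∈ {1, Λ, α ⋆ β}`, and control of the main terms (8.4); "an inspection of these
  arguments reveals that they would be equally valid if one inserted a further non-negative weight
  `ω`", giving `∑_n ν(n) 1_A(n) ω(n) > 0` from the weighted inputs (8.5), (8.6). For `H₁ ≤ 4` one
  would use `A' = {n : n, n+2 both prime} ∪ {n : n+2, n+6 both prime}` (8.7) and the weight
  `ω(n) = (1 - λ(n)λ(n+2))(1 - λ(n+2)λ(n+6))`; "Observe that `ω` vanishes for any `n ∈ A'`, and
  hence `∑_n ν(n) 1_{A'}(n) ω(n) = 0` for any `ν`" (8.9); the Möbius randomness law "predicts"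
  `∑_{x≤n≤2x: n=a (q)} λ(n+h) = O(x/q · log^{-A} x)` "for any residue class `a (q)` with
  `q ≤ x^{1-ε}`, and any `h ∈ {0,2,6}`; similarly for … `∑ λ(n+2)λ(n+6)` … `∑ Λ(n)λ(n+2)λ(n+6)` …
  `∑ f(n)λ(n+2)λ(n+6)`", and "`(α ⋆ β)λ = (αλ) ⋆ (βλ)`"; "we conclude (heuristically, at least)
  that all the bounds that are believed to hold for (8.3), (8.4) should also hold … for (8.5),
  (8.6). Thus, if the bound `H₁ ≤ 4` could be proven in a sieve-theoretic fashion, one should be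
  able to conclude the bound (8.8), which is in direct contradiction to (8.9)." p. 36: "The same
  arguments of course also prohibit a sieve-theoretic proof of the twin prime conjecture
  `H₁ = 2`. In this case one can use the simpler weight `ω(n) = 1 - λ(n)λ(n+2)` to rule out such a
  proof, and the argument is essentially due to Selberg"; "the parity barrier could be
  circumvented if one were able to introduce stronger sieve-theoretic axioms than the "linear"
  axioms currently available … bilinear expressions such as
  `∑_{x≤n≤2x} f(n)Λ(n+2) = ∑_d ∑_m α(d)β(m) 1_{[x,2x]}(dm) Λ(dm+2)` … Unfortunately, we do not
  know of any plausible way to control such bilinear expressions."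
* J. Friedlander, *Producing prime numbers via sieve methods* (Cetraro 2002), LNM 1891 (2006), §1
  "Parity Problem" and "Bombieri's Sieve" [cite: Friedlander2006ProducingPrimes, §1]: Selberg's
  examples; Bombieri's theorem for `k ≥ 2` with level `D = x^{1-ε}`, its failure for `k = 1`, and
  the factor `α ∈ [0, 2]` (tree: `ParityBarrier.lean`).

## Verdict clean-up (2026-08-15): the two Möbius-randomness inputs are OPEN CONJECTURES, not debt

Both inputs were vendored as cite-tagged named facts and therefore seated as literature debt; their
tenured prove-seats returned the verdict *open problem* for each, and the verdicts were re-verified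
here against the source and the tree:

* where POSED — arXiv:1407.4897 p. 35 (§8): "the "Möbius randomness law" (see e.g. [ik]) predicts
  a significant amount of cancellation … For instance, the expression `∑_{x≤n≤2x: n=a (q)} λ(n+h)`
  is expected to be very small (of size `O(x/q log^{-A} x)` for any fixed `A`) for any residue
  class `a (q)` with `q ≤ x^{1-ε}`, and any `h ∈ {0,2,6}`; similarly for more complicated
  expressions such as `∑_{x≤n≤2x: n=a (q)} λ(n+2)λ(n+6)`", with the footnote "Indeed, one might be
  even more ambitious and conjecture a square-root cancellation `⪍ √(x/q)` for such sums (see [mont]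
  for some similar conjectures)" ([mont] = Montgomery, *Topics in Multiplicative Number Theory*,
  LNM 227, 1971); p. 36: "In view of these observations (and similar observations arising from
  permutations of `{0,2,6}`), we conclude (heuristically, at least) …". The source PREDICTS these
  bounds; it proves neither, and §8 is by its own account "somewhat informal and heuristic";
* why OPEN — `Polymath2014_liouvillePairAP` already at the trivial modulus `q = 1` is dyadic
  two-point Chowla with a log-power saving and implies the `k = 2`, `h = (0, 2)` instance of
  `Literature.NumberTheory.Sieve.ChowlaConjecture` (kernel-checked in the companion file:
  `Polymath2014_liouvillePairAP.dyadic`, `Polymath2014_liouvillePairAP.chowla_zero_two` in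
  `PrimePairParityProofs.lean`), which is open; `Polymath2014_liouvilleShiftAPConjecture` asks for
  `(log x)^{-A}` cancellation of `λ` in EVERY residue class to EVERY modulus `q ≤ x^{1-ε}` — an
  Elliott–Halberstam/Montgomery-type hypothesis for `λ`, pointwise in the class — whereas the
  proved range is Siegel–Walfisz, `q ≤ (log x)^A` (tree:
  `Literature.NumberTheory.LFunctions.SiegelWalfiszMoebius.liouville_progression`), and even the
  generalised Riemann hypothesis reaches only `q ≤ x^{1/2-ε}`.

Treatment (MARK-OPEN, CONVENTIONS §4: open conjectures are `def … : Prop`, never asserted): both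
docstrings now begin `OPEN CONJECTURE —`, cite where the statement is posed and carry
`[status: open]`; there is deliberately no `_holds` for either, and users take them as explicit
hypotheses `(h : …)`. `Polymath2014_liouvilleShiftAP` had no users and is RENAMED
`Polymath2014_liouvilleShiftAPConjecture`; `Polymath2014_liouvillePairAP` KEEPS its name because
`PrimePairParityProofs.lean` uses it (`Polymath2014_liouvillePairAP.dyadic`, `.chowla_zero_two`).
Both Lean statements are unchanged.

## Design notes

* `liouvilleR` is Mathlib's `ArithmeticFunction.liouville` cast to `ℝ` (`λ(p) = -1`,
  `|λ| ≤ 1` from the tree's `Literature.NumberTheory.Sieve.abs_liouville_le_one`).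
* The detection sums are finite sums over `[x, 2x]` (`weightedDetectionSum ν A ω x`); a deduction
  is asked to produce positivity at SOME scale `x` with SOME `ν ≥ 0` — the weakest demand, hence
  the largest technique class and the strongest no-go.
* Why the class is not defeated trivially: the no-go is relative to an arbitrary input class
  `Inputs`; its only non-logical content is that the SPECIFIC weights `ω` annihilate the target
  sets (`twinParityWeight_eq_zero`, `gapFourParityWeight_eq_zero`) while being non-negative and
  bounded (`≤ 2`), exactly the two properties the source uses; whether `Inputs ω` holds for a
  realistic input class is the (conjectural) Möbius-randomness statement, vendored separately.
-/

noncomputable section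

open Finset

namespace Literature.Barriers.Parity

/-! ### Liouville parity weights for prime pairs (Polymath 2014, §8; Selberg) -/

/-- The Liouville function `λ(n) = (-1)^{Ω(n)}` as a real number (Mathlib's
`ArithmeticFunction.liouville`, cast). [folklore] -/
def liouvilleR (n : ℕ) : ℝ :=
  (ArithmeticFunction.liouville n : ℝ)

/-- `λ(p) = -1` at primes. [folklore] -/
theorem liouvilleR_prime {p : ℕ} (hp : p.Prime) : liouvilleR p = -1 := by
  simp [liouvilleR, ArithmeticFunction.liouville_apply hp.ne_zero,
    ArithmeticFunction.cardFactors_apply_prime hp]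

/-- `|λ(n)| ≤ 1`. [folklore] -/
theorem abs_liouvilleR_le_one (n : ℕ) : |liouvilleR n| ≤ 1 :=
  Literature.NumberTheory.Sieve.abs_liouville_le_one n

/-- **The twin parity weight** `ω(n) = 1 - λ(n) λ(n+2)` ("In this case one can use the simpler
weight `ω(n) = 1 - λ(n)λ(n+2)` to rule out such a proof, and the argument is essentially due to
Selberg"). [cite: Polymath8b2014, §8 (p. 36)] -/
def twinParityWeight (n : ℕ) : ℝ :=
  1 - liouvilleR n * liouvilleR (n + 2)

/-- **The `H₁ ≤ 4` parity weight**
`ω(n) = (1 - λ(n)λ(n+2))(1 - λ(n+2)λ(n+6))`. [cite: Polymath8b2014, §8 (p. 35)] -/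
def gapFourParityWeight (n : ℕ) : ℝ :=
  (1 - liouvilleR n * liouvilleR (n + 2)) * (1 - liouvilleR (n + 2) * liouvilleR (n + 6))

/-- A product of two numbers of absolute value `≤ 1` is `≤ 1`, so `1 - λ(a)λ(b) ∈ [0, 2]`.
[folklore] -/
theorem one_sub_liouvilleR_mul_mem (a b : ℕ) :
    0 ≤ 1 - liouvilleR a * liouvilleR b ∧ 1 - liouvilleR a * liouvilleR b ≤ 2 := by
  have ha := abs_le.mp (abs_liouvilleR_le_one a)
  have hb := abs_le.mp (abs_liouvilleR_le_one b)
  have h : |liouvilleR a * liouvilleR b| ≤ 1 := by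
    rw [abs_mul]
    exact mul_le_one₀ (abs_liouvilleR_le_one a) (abs_nonneg _) (abs_liouvilleR_le_one b)
  have h' := abs_le.mp h
  constructor <;> linarith

/-- `ω ≥ 0`: the twin parity weight is a legitimate non-negative sieve insertion.
[cite: Polymath8b2014, §8] -/
theorem twinParityWeight_nonneg (n : ℕ) : 0 ≤ twinParityWeight n :=
  (one_sub_liouvilleR_mul_mem n (n + 2)).1

/-- `ω ≤ 2`. [cite: Polymath8b2014, §8] -/
theorem twinParityWeight_le_two (n : ℕ) : twinParityWeight n ≤ 2 :=
  (one_sub_liouvilleR_mul_mem n (n + 2)).2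

/-- **`ω` annihilates twin primes**: if `n` and `n + 2` are prime then `λ(n)λ(n+2) = 1` and
`ω(n) = 0`. [cite: Polymath8b2014, §8 (p. 36)] -/
theorem twinParityWeight_eq_zero {n : ℕ} (hn : n.Prime) (hn2 : (n + 2).Prime) :
    twinParityWeight n = 0 := by
  simp [twinParityWeight, liouvilleR_prime hn, liouvilleR_prime hn2]

/-- The `H₁ ≤ 4` weight is non-negative. [cite: Polymath8b2014, §8] -/
theorem gapFourParityWeight_nonneg (n : ℕ) : 0 ≤ gapFourParityWeight n :=
  mul_nonneg (one_sub_liouvilleR_mul_mem n (n + 2)).1 (one_sub_liouvilleR_mul_mem (n + 2) (n + 6)).1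

/-- **The `H₁ ≤ 4` weight annihilates `A' = {n : n, n+2 prime} ∪ {n : n+2, n+6 prime}`**
("Observe that `ω` vanishes for any `n ∈ A'`"). [cite: Polymath8b2014, §8 (8.8)–(8.9)] -/
theorem gapFourParityWeight_eq_zero {n : ℕ}
    (h : (n.Prime ∧ (n + 2).Prime) ∨ ((n + 2).Prime ∧ (n + 6).Prime)) :
    gapFourParityWeight n = 0 := by
  rcases h with ⟨h0, h2⟩ | ⟨h2, h6⟩
  · simp [gapFourParityWeight, liouvilleR_prime h0, liouvilleR_prime h2]
  · simp [gapFourParityWeight, liouvilleR_prime h2, liouvilleR_prime h6]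

/-! ### Weighted sieve lower bounds and the technique class -/

/-- The set of twin-prime first members `{n : n, n + 2 prime}` (the set whose infinitude is the
twin prime conjecture `H₁ = 2`). [cite: Polymath8b2014, §8] -/
def twinSet : Set ℕ := {n | n.Prime ∧ (n + 2).Prime}

/-- Polymath's `A' = {n : n, n+2 both prime} ∪ {n : n+2, n+6 both prime}`, whose infinitude would
give `H₁ ≤ 4`. [cite: Polymath8b2014, §8 (8.7)] -/
def gapFourSet : Set ℕ := {n | (n.Prime ∧ (n + 2).Prime) ∨ ((n + 2).Prime ∧ (n + 6).Prime)}

open Classical in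
/-- The weighted detection sum `∑_{x ≤ n ≤ 2x} ν(n) 1_A(n) ω(n)` of a sieve weight `ν` against a set
`A` with an inserted weight `ω`. [cite: Polymath8b2014, §8] -/
def weightedDetectionSum (ν : ℕ → ℝ) (A : Set ℕ) (ω : ℕ → ℝ) (x : ℕ) : ℝ :=
  ∑ n ∈ Icc x (2 * x), ν n * A.indicator 1 n * ω n

/-- For EVERY `ν` and every scale, the `ω`-weighted detection sum of the twins vanishes
(Polymath's (8.9) for the twin weight). [cite: Polymath8b2014, §8 (8.9) and p. 36] -/
theorem weightedDetectionSum_twin (ν : ℕ → ℝ) (x : ℕ) :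
    weightedDetectionSum ν twinSet twinParityWeight x = 0 := by
  refine Finset.sum_eq_zero fun n _ => ?_
  by_cases hn : n ∈ twinSet
  · rw [twinParityWeight_eq_zero hn.1 hn.2, mul_zero]
  · rw [Set.indicator_of_notMem hn, mul_zero, zero_mul]

/-- For every `ν` and every scale, the `ω`-weighted detection sum of `A'` vanishes ((8.9)).
[cite: Polymath8b2014, §8 (8.9)] -/
theorem weightedDetectionSum_gapFour (ν : ℕ → ℝ) (x : ℕ) :
    weightedDetectionSum ν gapFourSet gapFourParityWeight x = 0 := by
  refine Finset.sum_eq_zero fun n _ => ?_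
  by_cases hn : n ∈ gapFourSet
  · rw [gapFourParityWeight_eq_zero hn, mul_zero]
  · rw [Set.indicator_of_notMem hn, mul_zero, zero_mul]

/-- **Technique class (explicit): sieve-theoretic deductions.** Following Polymath §8: a proof
of `∑_n ν(n) 1_A(n) > 0` is *sieve-theoretic relative to the axioms `Inputs`* if it derives the
lower bound only from the distributional inputs (bounds on the discrepancies (8.3) and asymptotics
for the main terms (8.4)), so that "an inspection of these arguments reveals that they would be
equally valid if one inserted a further non-negative weight `ω`" enjoying the same inputs
((8.5), (8.6)): for EVERY `ω ≥ 0` satisfying `Inputs ω` it yields some scale `x` and some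
`ν ≥ 0` with `∑_{x ≤ n ≤ 2x} ν(n) 1_A(n) ω(n) > 0`. The predicate `Inputs` (which weighted
discrepancy/main-term estimates the argument consumes) is a parameter: the barrier below holds for
every choice. [cite: Polymath8b2014, §8 (8.3)–(8.6)] -/
def IsSieveTheoreticDeduction (Inputs : (ℕ → ℝ) → Prop) (A : Set ℕ) : Prop :=
  ∀ ω : ℕ → ℝ, (∀ n, 0 ≤ ω n) → Inputs ω →
    ∃ x : ℕ, ∃ ν : ℕ → ℝ, (∀ n, 0 ≤ ν n) ∧ 0 < weightedDetectionSum ν A ω x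

/-- The unweighted case `ω = 1` of a sieve-theoretic deduction is an ordinary lower bound
`∑ ν 1_A > 0`, hence produces an element of `A` in `[x, 2x]`. [cite: Polymath8b2014, §8] -/
theorem IsSieveTheoreticDeduction.exists_mem {Inputs : (ℕ → ℝ) → Prop} {A : Set ℕ}
    (h : IsSieveTheoreticDeduction Inputs A) (h1 : Inputs fun _ => 1) :
    ∃ x n : ℕ, n ∈ Icc x (2 * x) ∧ n ∈ A := by
  obtain ⟨x, ν, -, hpos⟩ := h (fun _ => 1) (fun _ => zero_le_one) h1
  by_contra hnone
  push Not at hnone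
  refine (lt_irrefl (0 : ℝ)) (hpos.trans_eq ?_)
  refine Finset.sum_eq_zero fun n hn => ?_
  classical
  rw [Set.indicator_of_notMem (hnone x n hn), mul_zero, zero_mul]


/-! ### The barrier -/

/-- **Barrier: the parity obstruction for prime pairs (Selberg; Bombieri 1976; Polymath 2014, §8).**
No sieve-theoretic deduction — one that survives the insertion of an arbitrary non-negative weight
`ω` enjoying the same distributional inputs — can produce twin primes (`H₁ = 2`) or the set `A'`
behind `H₁ ≤ 4`, PROVIDED the Liouville-twisted weights `ω(n) = 1 - λ(n)λ(n+2)`, resp.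
`(1 - λ(n)λ(n+2))(1 - λ(n+2)λ(n+6))`, satisfy those inputs (the Möbius-randomness heuristic of the
source, isolated here as the explicit hypothesis `Inputs ω`). PROVED below (`PrimePairParity_holds`)
for EVERY choice of the input axioms `Inputs`.

BARRIER
technique_class: sieve-theoretic linear-sieve-axioms type-I-discrepancy-bounds elliott-halberstam generalized-elliott-halberstam weight-insertion-invariant — `IsSieveTheoreticDeduction Inputs A`: deductions of `∑ ν 1_A > 0` from (averaged) bounds on the discrepancies `|∑_{x≤n≤2x, n≡a (q)} f(n+h) - φ(q)⁻¹ ∑_{(n+h,q)=1} f(n+h)|`, `f ∈ {1, Λ, α ⋆ β}`, `q ≤ x^{1-ε}`, and asymptotics for the main terms, which "would be equally valid if one inserted a further non-negative weight `ω`" with the same weighted inputs [cite: Polymath8b2014, §8 (8.3)–(8.6)].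
blocks: sieve-theoretic proofs of the twin prime conjecture `H₁ = 2` (infinitude of `twinSet`, the `d = 1, t = 2` instance `(n, n+2)` = `Literature.NumberTheory.Sieve.twinPrimeSystem` of `GeneralizedHardyLittlewood`) and of `H₁ ≤ 4` via `gapFourSet = A'`, "even on the assumption of strong distributional conjectures such as the generalized Elliott-Halberstam conjecture `GEH[ϑ]`, and even if one uses sieves other than the Selberg sieve" [cite: Polymath8b2014, §8 (p. 35) and Theorem 1.4 (xii) discussion p. 3]; consistently, under Elliott–Halberstam Bombieri's asymptotic sieve determines `∑_{n≤x} Λ_k(n) Λ(n+2)` for every `k ≥ 2` but not for `k = 1` (tree facts `Literature.NumberTheory.Sieve.bombieri_asymptotic_sieve_shiftedPrimes`, `Literature.NumberTheory.Sieve.bombieri_asymptotic_sieve_indeterminacy`) [cite: Friedlander2006ProducingPrimes, §1 "Bombieri's sieve"].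
because: `ω(n) = 1 - λ(n)λ(n+2) ≥ 0` vanishes whenever `n, n+2` are both prime (`λ = -1` at primes), so `∑_n ν(n) 1_A(n) ω(n) = 0` for EVERY `ν` (`weightedDetectionSum_twin`; (8.8)–(8.9) for `A'`: `weightedDetectionSum_gapFour`), while "the "Möbius randomness law" … predicts" that the weighted discrepancies and main terms obey "all the bounds that are believed to hold" in the unweighted case — `∑_{x≤n≤2x: n≡a (q)} λ(n+h)` "is expected to be very small (of size `O(x/q · log^{-A} x)` for any fixed `A`) for any residue class `a (q)` with `q ≤ x^{1-ε}`", likewise `∑ λ(n+2)λ(n+6)`, `∑ Λ(n)λ(n+2)λ(n+6)`, `∑ f(n)λ(n+2)λ(n+6)`, and `(α ⋆ β)λ = (αλ) ⋆ (βλ)` keeps the GEH class stable (registered open conjectures `Polymath2014_liouvilleShiftAPConjecture`, `Polymath2014_liouvillePairAP`); "Thus, if the bound `H₁ ≤ 4` could be proven in a sieve-theoretic fashion, one should be able to conclude the bound (8.8), which is in direct contradiction to (8.9)"; "The same arguments of course also prohibit a sieve-theoretic proof of the twin prime conjecture `H₁ = 2` … the argument is essentially due to Selberg" [cite: Polymath8b2014,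 §8 (pp. 35–36)].
evasions_known: "the parity barrier could be circumvented if one were able to introduce stronger sieve-theoretic axioms than the "linear" axioms currently available", e.g. non-trivial bounds for bilinear sums `∑_d ∑_m α(d) β(m) 1_{[x,2x]}(dm) Λ(dm+2)`, which "would soon lead to a proof of the twin prime conjecture. Unfortunately, we do not know of any plausible way to control such bilinear expressions"; bilinear axioms ARE available in other settings (Friedlander–Iwaniec, primes `a² + b⁴`) [cite: Polymath8b2014, §8 (p. 36)]; the obstruction does not touch `H₁ ≤ 6` under GEH (Theorem 1.4 (xii)), nor does it exclude reaching (xii) from `EH[ϑ]` alone [cite: Polymath8b2014, §1 (p. 3)]; in the one-sequence setting, Type I plus Type II information of sufficient width (`γ + ν > 1`, or the criterion of Theorem 2.2) yields an asymptotic for `∑_p a_p`, while for every `γ < 1` some positive Type II width `ν₀(γ)` is NECESSARY (Liouville-like counterexamples) [cite: FordMaynard2024PrimeSieves, §1 (p. 3), Theorem 2.2 and Theorem 2.1].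
scope_caveats: (a) the source's §8 is by its own statement "somewhat informal and heuristic in nature": the transfer of the inputs to the `ω`-weighted sums rests on the Möbius randomness law (conjectural Chowla/Elliott-type cancellation in progressions to level `x^{1-ε}`), NOT on a theorem — here this is the explicit hypothesis `Inputs ω`, and the printed predictions are vendored as the registered OPEN CONJECTURES `Polymath2014_liouvilleShiftAPConjecture`, `Polymath2014_liouvillePairAP` (`[status: open]`, no `_holds`) [cite: Polymath8b2014, §8 (p. 35)]; contrast Selberg's one-prime weight `1 + λ(n)`, whose Type-I data are unconditionally those of the integers (`Literature.NumberTheory.Sieve.selbergParitySeq_hasLevelOfDistribution`, prime number theorem for `λ`) [cite: Friedlander2006ProducingPrimes, §1 "Parity Problem"]; (b) "sieve-theoretic" is made precise only as invariance under weight insertion relative to a chosen input class (`IsSieveTheoreticDeduction Inputs`); which concrete arguments have this invariance is asserted by inspection in the source ("an inspection of these arguments reveals"), not proved; (c) Remark 8.1 (sets `A_H`) is not formalised [cite: Polymath8b2014, Remark 8.1].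
status: established as a conditional schema (proved: `PrimePairParity_holds`); the inputs for the twisted weights are conjectural (Möbius randomness) [cite: Polymath8b2014, §8]. -/
def PrimePairParity : Prop :=
  ∀ Inputs : (ℕ → ℝ) → Prop,
    (Inputs twinParityWeight → ¬ IsSieveTheoreticDeduction Inputs twinSet) ∧
    (Inputs gapFourParityWeight → ¬ IsSieveTheoreticDeduction Inputs gapFourSet)

/-- **Proof of the barrier schema.** [cite: Polymath8b2014, §8 (8.8)–(8.9)] -/
theorem PrimePairParity_holds : PrimePairParity := by
  intro Inputs
  constructor
  · intro hIn hded
    obtain ⟨x, ν, -, hpos⟩ := hded twinParityWeight twinParityWeight_nonneg hIn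
    rw [weightedDetectionSum_twin] at hpos
    exact lt_irrefl 0 hpos
  · intro hIn hded
    obtain ⟨x, ν, -, hpos⟩ := hded gapFourParityWeight gapFourParityWeight_nonneg hIn
    rw [weightedDetectionSum_gapFour] at hpos
    exact lt_irrefl 0 hpos

/-- Reformulation: relative to any input class containing the twin parity weight, every
weight-insertion-invariant deduction FAILS to detect twins for some admissible weight — namely for
`ω = 1 - λ(n)λ(n+2)`, at every scale and for every `ν ≥ 0`. [cite: Polymath8b2014, §8] -/
theorem twinParityWeight_defeats (ν : ℕ → ℝ) (x : ℕ) :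
    ¬ 0 < weightedDetectionSum ν twinSet twinParityWeight x := by
  rw [weightedDetectionSum_twin]; exact lt_irrefl 0

/-! ### The conjectural inputs, as printed: registered OPEN CONJECTURES (Möbius randomness in progressions) -/

/-- OPEN CONJECTURE — **Polymath's Möbius-randomness prediction for shifted Liouville sums in
arithmetic progressions**, POSED (as a heuristic prediction, not as a theorem) in D. H. J. Polymath,
*Variants of the Selberg sieve, and bounded intervals containing many primes*, Res. Math. Sci. 1:12
(2014), §8 "The parity problem", arXiv:1407.4897 p. 35 [cite: Polymath8b2014, §8 (p. 35)]
[status: open]: "the "Möbius randomness law" (see e.g. [ik]) predicts a significant amount of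
cancellation for any non-trivial sum involving the Möbius function `μ`, or the closely related
Liouville function `λ`. For instance, the expression `∑_{x ≤ n ≤ 2x: n = a (q)} λ(n+h)` is expected
to be very small (of size `O(x/q log^{-A} x)` for any fixed `A`) for any residue class `a (q)`
with `q ≤ x^{1-ε}`, and any `h ∈ {0,2,6}`" — i.e. for `h ∈ {0, 2, 6}` and all fixed `ε, A > 0`
there are `C, x₀` with `|∑_{x ≤ n ≤ 2x, n ≡ a (q)} λ(n + h)| ≤ C · (x/q) / log^A x` for all
`x ≥ x₀`, all `1 ≤ q ≤ x^{1-ε}` and every class `a (mod q)`. An Elliott–Halberstam/Montgomery-type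
hypothesis for `λ`, POINTWISE in the residue class, at level `x^{1-ε}` (the source's footnote:
"one might be even more ambitious and conjecture a square-root cancellation `⪍ √(x/q)` for such
sums (see [mont] for some similar conjectures)", [mont] = Montgomery, LNM 227). Proved nowhere:
the unconditional range is Siegel–Walfisz, `q ≤ (log x)^A`
(tree: `Literature.NumberTheory.LFunctions.SiegelWalfiszMoebius.liouville_progression`), and the
generalised Riemann hypothesis gives only `q ≤ x^{1/2-ε}`. Hence there is deliberately no
`_holds`; it is the source's INPUT to the heuristic half of the parity argument (the hypothesis
`Inputs ω` of `PrimePairParity`) and is to be used only as an explicit hypothesis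
`(h : Polymath2014_liouvilleShiftAPConjecture)`. Formerly `Polymath2014_liouvilleShiftAP` (renamed
2026-08-15 after the verdict of the tenured prove-seat — open problem — was re-verified against
arXiv:1407.4897 pp. 35–36; statement unchanged; it had no users). -/
@[conjecture] def Polymath2014_liouvilleShiftAPConjecture : Prop :=
  ∀ h ∈ ({0, 2, 6} : Finset ℕ), ∀ ε A : ℝ, 0 < ε → 0 < A → ∃ C : ℝ, ∃ x₀ : ℕ, ∀ x : ℕ, x₀ ≤ x →
    ∀ q : ℕ, 1 ≤ q → (q : ℝ) ≤ (x : ℝ) ^ (1 - ε) → ∀ a : ZMod q,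
      |∑ n ∈ (Icc x (2 * x)).filter (fun n : ℕ => (n : ZMod q) = a), liouvilleR (n + h)| ≤
        C * ((x : ℝ) / q) / Real.log x ^ A

/-- OPEN CONJECTURE — **Polymath's Möbius-randomness prediction for two-point Liouville
correlations in arithmetic progressions**, POSED (as a heuristic prediction, not as a theorem)
ibid., §8, arXiv:1407.4897 pp. 35–36 [cite: Polymath8b2014, §8 (pp. 35–36)] [status: open]:
"similarly for more complicated expressions such as `∑_{x ≤ n ≤ 2x: n = a (q)} λ(n+2)λ(n+6)`"
(p. 35, same size `O(x/q log^{-A} x)`, same range `q ≤ x^{1-ε}`, every class `a (q)`), and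
"In view of these observations (and similar observations arising from permutations of `{0,2,6}`),
we conclude (heuristically, at least) …" (p. 36) — i.e. for each pair `(h₁, h₂) ∈ {(0,2), (2,6),
(0,6)}` and all fixed `ε, A > 0` there are `C, x₀` with
`|∑_{x ≤ n ≤ 2x, n ≡ a (q)} λ(n + h₁) λ(n + h₂)| ≤ C · (x/q) / log^A x` for all `x ≥ x₀`, all
`1 ≤ q ≤ x^{1-ε}` and every class `a (mod q)`. A two-point Chowla conjecture in arithmetic
progressions to level `x^{1-ε}`. Proved nowhere: already its trivial-modulus case `q = 1` for the
pair `(0, 2)` is dyadic binary Chowla with a log-power saving (`Polymath2014_liouvillePairAP.dyadic`)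
and implies the `k = 2`, `h = (0, 2)` instance of `Literature.NumberTheory.Sieve.ChowlaConjecture`
(`Polymath2014_liouvillePairAP.chowla_zero_two`, both kernel-checked in `PrimePairParityProofs.lean`),
which is open — only the logarithmically averaged two-point statement is known
(tree: `Literature.NumberTheory.LFunctions.tao_log_chowla_two`). Hence there is deliberately no
`_holds`; it is the source's INPUT to the heuristic half of the parity argument and is to be used
only as an explicit hypothesis `(h : Polymath2014_liouvillePairAP)`. Name KEPT (not renamed
`…Conjecture`) because `PrimePairParityProofs.lean` uses it; verdict of the tenured prove-seat
(open problem) re-verified 2026-08-15 against arXiv:1407.4897 pp. 35–36; statement unchanged. -/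
@[conjecture] def Polymath2014_liouvillePairAP : Prop :=
  ∀ h₁ h₂ : ℕ, (h₁, h₂) ∈ ({(0, 2), (2, 6), (0, 6)} : Finset (ℕ × ℕ)) →
    ∀ ε A : ℝ, 0 < ε → 0 < A → ∃ C : ℝ, ∃ x₀ : ℕ, ∀ x : ℕ, x₀ ≤ x →
    ∀ q : ℕ, 1 ≤ q → (q : ℝ) ≤ (x : ℝ) ^ (1 - ε) → ∀ a : ZMod q,
      |∑ n ∈ (Icc x (2 * x)).filter (fun n : ℕ => (n : ZMod q) = a),
          liouvilleR (n + h₁) * liouvilleR (n + h₂)| ≤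
        C * ((x : ℝ) / q) / Real.log x ^ A

end Literature.Barriers.Parity
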